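import Summits.HodgeConjecture.HodgeConjecture.Theorems.LinearSystemTorelliLocalTubeSpanFrameLiftCounting
import Summits.HodgeConjecture.HodgeConjecture.Theorems.LinearSystemTorelliLocalTubeSpanFrameLiftBasic
import Summits.HodgeConjecture.HodgeConjecture.Theorems.LinearSystemTorelliLocalTubeSpanIndexBookkeeping
import Summits.HodgeConjecture.HodgeConjecture.Theorems.LinearSystemTorelliLocalTubeSpanShearLattice
import Mathlib.LinearAlgebra.Projection

/-!
# Route LinearSystemTorelli — crux `LocalTubeSpan` (stmt-HodgeConjecture-2490): the FRAME LIFT (Schnell's Lemma 11 for degenerate lattices)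

Helper file (`--supports stmt-HodgeConjecture-2490`, line `Sketch` of the crux chain, cycle 6,
continuation lead c5; the lead's stub `stub_frameLift`, second half).

Schnell's Lemma 11 ([Schnell2010] §7, from Janssen's Theorem 2.5 and Lemma 2.7): a skew vanishing
lattice `Δ` in a space of dimension `r'` contains `r'` linearly independent elements whose
transvections generate a finite-index subgroup of the monodromy group `Γ_Δ`.  The line uses it
(named fact `Schnell2010_lemma11`) for the DEGENERATE local lattices at the non-isolated members
`Y₁ ∪ Y₂` (`…Radical`, `…_of_completeOrbit`).  This file proves the LIFTING STEP that reduces the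
degenerate case to the nondegenerate one:

* `localTubeSpan_frameLift` — let `R = ker B` be the radical and suppose given lifts
  `δ₁, …, δ_r ∈ Δ` of a frame of `V / R` (linearly independent modulo `R`, `r = dim V/R`) and
  finitely many `c ∈ Γ_Δ` such that every `g ∈ Γ_Δ` agrees modulo `R` with some `c · h`,
  `h ∈ Γ_{δ_•}` (this is what Lemma 11 downstairs provides, `…QuotientTransfer`).  Then `Δ`
  contains `dim V` linearly independent elements whose transvection group has finite index in `Γ_Δ`.

Proof.  `V = V₀ ⊕ R` with `V₀ = ℚδ_•`.  Complete the lifted frame by `e₁, …, e_k ∈ Δ` whose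
`R`-components `β_j` form a basis of `R` (`Δ` spans).  Let `U_Γ ⊴ Γ_Δ` be the elements acting
trivially modulo `R`; `g ↦ g - 1` embeds `U_Γ` additively into the lattice of shears
`{φ | im φ ⊆ R ⊆ ker φ, φ(ℤΔ) ⊆ ℤΔ}`, free of rank `≤ r·k` (`…ShearLattice`).  The subgroup
`Γ'' U_Γ` (`Γ'' = Γ_{δ_•}`) has finite index (the cosets), so some power `T_{e_j}^m` lies in it:
`T_{e_j}^m = h u` with `h ∈ Γ''`, `u ∈ U_Γ ∩ Γ'` (`Γ'` the transvection group of the completed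
frame), and since `h` preserves `V₀` and `u ≡ 1 (mod R)`, necessarily
`u - 1 = -m⟨·, e_j⟩ β_j` (`…FrameLiftCounting`, the shear formula; basics on `Γ_Δ` in `…FrameLiftBasic`).  Conjugating by `g ∈ Γ''`
gives the shears `-m⟨·, g e_j⟩ β_j`, and the `g e_j` span `V` modulo `R` (`…OrbitSpan` applied to
`Γ'' U_Γ`), so `Γ' ∩ U_Γ` contains `r·k` independent shears: finite index in `U_Γ` by the counting
lemma, and `[Γ_Δ : Γ'] < ∞` by `…IndexBookkeeping`.

No named facts; no `sorry`.
-/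

-- `Summit.HodgeConjecture.HodgeConjecture.Theorems` is the mandated namespace (single-conjunct summit:
-- Sub = Summit), which `linter.dupNamespace` flags on every declaration; the lakefile turns the
-- linter off tree-wide (weak option), restated here so stand-alone elaboration is warning-free too.
set_option linter.dupNamespace false

noncomputable section

open Literature.AlgebraicGeometry.HodgeTheory

namespace Summit.HodgeConjecture.HodgeConjecture.Theorems

/-! ### The frame lift -/

section FrameLift

variable {V : Type} [AddCommGroup V] [Module ℚ V]

/-- **The frame lift (Schnell's Lemma 11 for degenerate lattices, lifting step).**  Let `Δ` be a
skew vanishing lattice for the alternating form `B` on the finite-dimensional `ℚ`-space `V`, with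
radical `R = ker B`.  Suppose `δ₁, …, δ_r ∈ Δ` (`r = dim V/R`) are linearly independent modulo
`R` and finitely many `c ∈ Γ_Δ` are given such that every `g ∈ Γ_Δ` agrees modulo `R` with some
`c · h`, `h ∈ Γ_{δ_•}` — the conclusion of Lemma 11 for the NONDEGENERATE quotient lattice, read
upstairs.  Then there are `dim V` linearly independent elements of `Δ` whose transvection group has
finite index in `Γ_Δ` — the conclusion of Lemma 11 for `Δ` itself.
[cite: Schnell2010, §7 Lemma 11] -/
theorem localTubeSpan_frameLift [FiniteDimensional ℚ V] (B : LinearMap.BilinForm ℚ V)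
    (hB : B.IsAlt) (Δ : Set V) (hΔ : IsSkewVanishingLattice B Δ) {r : ℕ} (δ : Fin r → V)
    (hr : r = Module.finrank ℚ (V ⧸ LinearMap.ker B)) (hδΔ : ∀ i, δ i ∈ Δ)
    (hli : LinearIndependent ℚ ((LinearMap.ker B).mkQ ∘ δ))
    (C : Finset (V →ₗ[ℚ] V)ˣ) (hC : ∀ c ∈ C, c ∈ transvectionGroup B Δ)
    (hcos : ∀ g ∈ transvectionGroup B Δ, ∃ c ∈ C, ∃ h ∈ transvectionGroup B (Set.range δ),
      ∀ x : V, (g : V →ₗ[ℚ] V) x - ((c * h : (V →ₗ[ℚ] V)ˣ) : V →ₗ[ℚ] V) x ∈ LinearMap.ker B) :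
    ∃ (r' : ℕ) (δ' : Fin r' → V), r' = Module.finrank ℚ V ∧ (∀ i, δ' i ∈ Δ) ∧
      LinearIndependent ℚ δ' ∧
      ((transvectionGroup B (Set.range δ')).subgroupOf (transvectionGroup B Δ)).FiniteIndex := by
  classical
  -- notation
  set R : Submodule ℚ V := LinearMap.ker B with hRdef
  set Γ : Subgroup (V →ₗ[ℚ] V)ˣ := transvectionGroup B Δ with hΓdef
  set Γ'' : Subgroup (V →ₗ[ℚ] V)ˣ := transvectionGroup B (Set.range δ) with hΓ''def
  have hδsub : Set.range δ ⊆ Δ := by rintro _ ⟨i, rfl⟩; exact hδΔ i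
  have hΓ''Γ : Γ'' ≤ Γ := transvectionGroup_mono B hδsub
  -- basic facts on `Γ`
  have hfixR : ∀ g ∈ Γ, ∀ x ∈ R, ((g : (V →ₗ[ℚ] V)ˣ) : V →ₗ[ℚ] V) x = x := fun g hg x hx =>
    localTubeSpan_transvectionGroup_apply_of_mem_ker B hB Δ hg hx
  have hiso : ∀ g ∈ Γ, ∀ x y, B (((g : (V →ₗ[ℚ] V)ˣ) : V →ₗ[ℚ] V) x)
      (((g : (V →ₗ[ℚ] V)ˣ) : V →ₗ[ℚ] V) y) = B x y := fun g hg x y =>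
    localTubeSpan_transvectionGroup_isometry B hB Δ hg x y
  -- `R`, the radical: `B x r = 0` for `r ∈ R`, and conversely
  have hRright : ∀ r ∈ R, ∀ x, B x r = 0 := fun r hr x => by
    rw [← hB.neg_eq, show B r = 0 from LinearMap.mem_ker.1 hr, LinearMap.zero_apply, neg_zero]
  have hRof : ∀ v : V, (∀ x, B x v = 0) → v ∈ R := fun v hv => by
    rw [hRdef, LinearMap.mem_ker]
    ext y
    rw [LinearMap.zero_apply, ← hB.neg_eq, hv y, neg_zero]
  -- the complement `V₀ = ℚδ_•`
  set V₀ : Submodule ℚ V := Submodule.span ℚ (Set.range δ) with hV₀def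
  have hδli : LinearIndependent ℚ δ := hli.of_comp _
  have hdisj : V₀ ⊓ R = ⊥ := by
    refine (Submodule.eq_bot_iff _).2 fun x hx => ?_
    obtain ⟨c, rfl⟩ := (Submodule.mem_span_range_iff_exists_fun ℚ).1 hx.1
    have h0 : ∑ i, c i • ((LinearMap.ker B).mkQ ∘ δ) i = 0 := by
      have : (LinearMap.ker B).mkQ (∑ i, c i • δ i) = 0 :=
        (Submodule.Quotient.mk_eq_zero _).2 hx.2
      simpa [map_sum, map_smul] using this
    have hc : ∀ i, c i = 0 := Fintype.linearIndependent_iff.1 hli c h0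
    simp [hc]
  have hfrV₀ : Module.finrank ℚ V₀ = r := by
    rw [hV₀def, finrank_span_eq_card hδli, Fintype.card_fin]
  have hsup : V₀ ⊔ R = ⊤ := by
    apply Submodule.eq_top_of_finrank_eq
    have h1 := Submodule.finrank_sup_add_finrank_inf_eq V₀ R
    rw [hdisj, finrank_bot, add_zero, hfrV₀] at h1
    have h2 := Submodule.finrank_quotient_add_finrank R
    omega
  have hcompl : IsCompl V₀ R := IsCompl.of_eq hdisj hsup
  have hdec : ∀ x : V, ∃ x₀ ∈ V₀, ∃ ρ ∈ R, x = x₀ + ρ := fun x => by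
    obtain ⟨x₀, hx₀, ρ, hρ, h⟩ := Submodule.mem_sup.1 (show x ∈ V₀ ⊔ R by rw [hsup]; trivial)
    exact ⟨x₀, hx₀, ρ, hρ, h.symm⟩
  have hV₀stab : ∀ g ∈ Γ'', ∀ x ∈ V₀, ((g : (V →ₗ[ℚ] V)ˣ) : V →ₗ[ℚ] V) x ∈ V₀ := fun g hg x hx =>
    localTubeSpan_transvectionGroup_map_span B hB (Set.range δ) hg hx
  -- the projection onto `R` along `V₀`, and the new basis vectors `e_j ∈ Δ`
  set k : ℕ := Module.finrank ℚ R with hkdef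
  let πR : V →ₗ[ℚ] R := Submodule.projectionOnto R V₀ hcompl.symm
  have hπR_V₀ : ∀ x ∈ V₀, πR x = 0 := fun x hx =>
    Submodule.projectionOnto_apply_right hcompl.symm ⟨x, hx⟩
  have hπR_R : ∀ x : R, πR x = x := fun x => Submodule.projectionOnto_apply_left hcompl.symm x
  have hπR_dec : ∀ x : V, x - (πR x : V) ∈ V₀ := fun x => by
    obtain ⟨x₀, hx₀, ρ, hρ, rfl⟩ := hdec x
    rw [map_add, hπR_V₀ x₀ hx₀, hπR_R ⟨ρ, hρ⟩, zero_add]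
    simpa using hx₀
  have hOspan : Submodule.span ℚ (πR '' Δ) = ⊤ := by
    rw [Submodule.span_image, hΔ.span_eq_top, Submodule.map_top]
    exact LinearMap.range_eq_top.2 (Submodule.projectionOnto_surjective hcompl.symm)
  obtain ⟨f, hfO, hfli⟩ :=
    localTubeSpan_exists_linearIndependent_of_span_eq_top (πR '' Δ) hOspan hkdef
  choose e heΔ heπ using fun j => (Set.mem_image _ _ _).1 (hfO j)
  -- `β_j = πR e_j` (a basis of `R`), `w_j = e_j - β_j ∈ V₀`
  set β : Fin k → V := fun j => (f j : V) with hβdef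
  have hβR : ∀ j, β j ∈ R := fun j => (f j).2
  have hβli : LinearIndependent ℚ β := hfli.map' R.subtype (Submodule.ker_subtype R)
  have hwV₀ : ∀ j, e j - β j ∈ V₀ := fun j => by
    have := hπR_dec (e j)
    rwa [heπ j] at this
  have heli : LinearIndependent ℚ e := by
    refine LinearIndependent.of_comp πR ?_
    rw [show (⇑πR ∘ e) = f from funext fun j => heπ j]
    exact hfli
  -- the completed frame
  have hdisj' : Disjoint (Submodule.span ℚ (Set.range δ)) (Submodule.span ℚ (Set.range e)) := by
    rw [Submodule.disjoint_def]
    intro x hxδ hxe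
    obtain ⟨d, rfl⟩ := (Submodule.mem_span_range_iff_exists_fun ℚ).1 hxe
    have h0 : ∑ j, d j • f j = 0 := by
      have h1 : πR (∑ j, d j • e j) = 0 := hπR_V₀ _ hxδ
      simpa [map_sum, map_smul, heπ] using h1
    have hd : ∀ j, d j = 0 := Fintype.linearIndependent_iff.1 hfli d h0
    simp [hd]
  have hsumli : LinearIndependent ℚ (Sum.elim δ e) := hδli.sum_type heli hdisj'
  let frame : Fin (r + k) → V := fun i => Sum.elim δ e (finSumFinEquiv.symm i)
  have hframe_range : Set.range frame = Set.range δ ∪ Set.range e := by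
    change Set.range (Sum.elim δ e ∘ finSumFinEquiv.symm) = _
    rw [finSumFinEquiv.symm.surjective.range_comp, Set.Sum.elim_range]
  have hframeΔ : ∀ i, frame i ∈ Δ := fun i => by
    change Sum.elim δ e (finSumFinEquiv.symm i) ∈ Δ
    rcases finSumFinEquiv.symm i with i | j
    · exact hδΔ i
    · exact heΔ j
  have hframeli : LinearIndependent ℚ frame := hsumli.comp _ finSumFinEquiv.symm.injective
  have hrk : r + k = Module.finrank ℚ V := by
    have h2 := Submodule.finrank_quotient_add_finrank R
    omega
  refine ⟨r + k, frame, hrk, hframeΔ, hframeli, ?_⟩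
  -- FINITE INDEX of `Γ' = Γ_{frame}` in `Γ`
  rw [hframe_range]
  set Γ' : Subgroup (V →ₗ[ℚ] V)ˣ := transvectionGroup B (Set.range δ ∪ Set.range e) with hΓ'def
  have hframesub : Set.range δ ∪ Set.range e ⊆ Δ := by
    rintro x (⟨i, rfl⟩ | ⟨j, rfl⟩)
    · exact hδΔ i
    · exact heΔ j
  have hΓ'Γ : Γ' ≤ Γ := transvectionGroup_mono B hframesub
  have hΓ''Γ' : Γ'' ≤ Γ' := transvectionGroup_mono B Set.subset_union_left
  -- the unipotent elements `U` and `N = Γ ⊓ U`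
  let U : Subgroup (V →ₗ[ℚ] V)ˣ :=
    { carrier := {g | ∀ x : V, (g : V →ₗ[ℚ] V) x - x ∈ R}
      one_mem' := fun x => by
        change ((1 : (V →ₗ[ℚ] V)ˣ) : V →ₗ[ℚ] V) x - x ∈ R
        rw [Units.val_one, Module.End.one_apply, sub_self]; exact R.zero_mem
      mul_mem' := fun {g h} hg hh x => by
        change ((g * h : (V →ₗ[ℚ] V)ˣ) : V →ₗ[ℚ] V) x - x ∈ R
        have e1 : ((g * h : (V →ₗ[ℚ] V)ˣ) : V →ₗ[ℚ] V) x - x =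
            ((g : V →ₗ[ℚ] V) ((h : V →ₗ[ℚ] V) x) - (h : V →ₗ[ℚ] V) x) +
              ((h : V →ₗ[ℚ] V) x - x) := by
          rw [Units.val_mul, Module.End.mul_apply]; abel
        rw [e1]
        exact R.add_mem (hg _) (hh x)
      inv_mem' := fun {g} hg x => by
        have e1 : ((g⁻¹ : (V →ₗ[ℚ] V)ˣ) : V →ₗ[ℚ] V) x - x =
            -(((g : V →ₗ[ℚ] V) (((g⁻¹ : (V →ₗ[ℚ] V)ˣ) : V →ₗ[ℚ] V) x)) -
              ((g⁻¹ : (V →ₗ[ℚ] V)ˣ) : V →ₗ[ℚ] V) x) := by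
          rw [localTubeSpan_units_apply_inv_apply]; abel
        change ((g⁻¹ : (V →ₗ[ℚ] V)ˣ) : V →ₗ[ℚ] V) x - x ∈ R
        rw [e1]
        exact R.neg_mem (hg _) }
  have hUmem : ∀ g : (V →ₗ[ℚ] V)ˣ, g ∈ U ↔ ∀ x : V, (g : V →ₗ[ℚ] V) x - x ∈ R := fun g => Iff.rfl
  set N : Subgroup (V →ₗ[ℚ] V)ˣ := Γ ⊓ U with hNdef
  have hNΓ : N ≤ Γ := inf_le_left
  have hnormN : ∀ g ∈ Γ, ∀ n ∈ N, g * n * g⁻¹ ∈ N := by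
    intro g hg n hn
    refine ⟨Γ.mul_mem (Γ.mul_mem hg hn.1) (Γ.inv_mem hg), (hUmem _).2 fun x => ?_⟩
    have hy := (hUmem n).1 hn.2 (((g⁻¹ : (V →ₗ[ℚ] V)ˣ) : V →ₗ[ℚ] V) x)
    have e1 := localTubeSpan_units_conj_apply_sub g n x
    rw [e1, hfixR g hg _ hy]
    exact hy
  -- cosets: every `g ∈ Γ` is `c * h * n` with `c ∈ C`, `h ∈ Γ''`, `n ∈ N`
  have hdecΓ : ∀ g ∈ Γ, ∃ c ∈ C, ∃ h ∈ Γ'', ∃ n ∈ N, g = c * h * n := by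
    intro g hg
    obtain ⟨c, hc, h, hh, hgx⟩ := hcos g hg
    have hch : c * h ∈ Γ := Γ.mul_mem (hC c hc) (hΓ''Γ hh)
    refine ⟨c, hc, h, hh, (c * h)⁻¹ * g, ⟨Γ.mul_mem (Γ.inv_mem hch) hg, (hUmem _).2 fun x => ?_⟩,
      by group⟩
    have e1 := localTubeSpan_units_inv_mul_apply_sub (c * h) g x
    rw [e1, hfixR _ (Γ.inv_mem hch) _ (hgx x)]
    exact hgx x
  -- `M = Γ'' ⊔ N` has finite index in `Γ`
  have hMfi : ((Γ'' ⊔ N).subgroupOf Γ).FiniteIndex := by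
    refine localTubeSpan_indexBookkeeping Γ (Γ'' ⊔ N) N (sup_le hΓ''Γ hNΓ) hNΓ hnormN C hC
      (fun g hg => ?_) ?_
    · obtain ⟨c, hc, h, hh, n, hn, rfl⟩ := hdecΓ g hg
      exact ⟨c, hc, h, Subgroup.mem_sup_left hh, n, hn, rfl⟩
    · have : (Γ'' ⊔ N) ⊓ N = N := inf_eq_right.2 le_sup_right
      rw [this, Subgroup.subgroupOf_self]
      infer_instance
  -- the transvections along the new basis vectors
  let te : Fin k → (V →ₗ[ℚ] V)ˣ := fun j =>
    LinearMap.GeneralLinearGroup.ofLinearEquiv (skewTransvectionEquiv B (hB.self_eq_zero (e j)))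
  have hte_val : ∀ j, ((te j : (V →ₗ[ℚ] V)ˣ) : V →ₗ[ℚ] V) = skewTransvection B (e j) := fun j => rfl
  have hteΓ : ∀ j, te j ∈ Γ := fun j =>
    unit_skewTransvection_mem_transvectionGroup B (heΔ j) (hB.self_eq_zero (e j))
  have hteΓ' : ∀ j, te j ∈ Γ' := fun j =>
    unit_skewTransvection_mem_transvectionGroup B (Or.inr ⟨j, rfl⟩) (hB.self_eq_zero (e j))
  -- a power lies in `Γ'' ⊔ N`: `te ^ m = h * u`
  have hpow : ∀ j, ∃ m : ℕ, 0 < m ∧ ∃ h ∈ Γ'', ∃ u ∈ N, te j ^ m = h * u := by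
    intro j
    obtain ⟨m, hmpos, -, hm⟩ := Subgroup.exists_pow_mem_of_index_ne_zero
      (Subgroup.FiniteIndex.index_ne_zero (H := (Γ'' ⊔ N).subgroupOf Γ)) (⟨te j, hteΓ j⟩ : Γ)
    rw [Subgroup.mem_subgroupOf, SubgroupClass.coe_pow] at hm
    obtain ⟨h, hh, u, hu, heq⟩ := localTubeSpan_mem_sup_decomp Γ'' N
      (fun h hh n hn => hnormN h (hΓ''Γ hh) n hn) hm
    exact ⟨m, hmpos, h, hh, u, hu, heq⟩
  choose m hmpos hh hhΓ'' u huN hpow_eq using hpow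
  -- `u j ∈ Γ' ⊓ N` and the shear formula `u x - x = -(m B(x, e j)) • β j`
  have huΓ' : ∀ j, u j ∈ Γ' := fun j => by
    have : u j = (hh j)⁻¹ * te j ^ (m j) := by rw [hpow_eq j]; group
    rw [this]
    exact Γ'.mul_mem (Γ'.inv_mem (hΓ''Γ' (hhΓ'' j))) (Γ'.pow_mem (hteΓ' j) _)
  have hushear : ∀ j (x : V), ((u j : (V →ₗ[ℚ] V)ˣ) : V →ₗ[ℚ] V) x - x =
      -((((m j : ℕ) : ℚ) * B x (e j)) • β j) := by
    intro j x
    refine localTubeSpan_shear_of_trivial_mod V₀ R hdisj hdec ((hh j : (V →ₗ[ℚ] V)ˣ) : V →ₗ[ℚ] V)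
      (hV₀stab (hh j) (hhΓ'' j)) (hfixR (hh j) (hΓ''Γ (hhΓ'' j)))
      (fun y => ((u j : (V →ₗ[ℚ] V)ˣ) : V →ₗ[ℚ] V) y)
      (fun y => ((te j ^ m j : (V →ₗ[ℚ] V)ˣ) : V →ₗ[ℚ] V) y)
      (fun y => ((m j : ℕ) : ℚ) * B y (e j)) (hwV₀ j) (hβR j) (fun y => ?_) (fun y => ?_)
      (fun y => (hUmem _).1 (huN j).2 y) x
    · rw [localTubeSpan_unit_pow_apply B (hte_val j) (hB.self_eq_zero (e j)) (m j) y,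
        sub_add_cancel]
    · rw [← Module.End.mul_apply, ← Units.val_mul, ← hpow_eq j]
  -- conjugates by `g ∈ Γ''`
  have hconj : ∀ j, ∀ g ∈ Γ'', ∀ x : V,
      ((g * u j * g⁻¹ : (V →ₗ[ℚ] V)ˣ) : V →ₗ[ℚ] V) x - x =
        -((((m j : ℕ) : ℚ) * B x ((g : V →ₗ[ℚ] V) (e j))) • β j) := by
    intro j g hg x
    rw [localTubeSpan_units_conj_apply_sub, hushear j, map_neg, map_smul,
      hfixR g (hΓ''Γ hg) _ (hβR j), ← hiso g (hΓ''Γ hg) (((g⁻¹ : (V →ₗ[ℚ] V)ˣ) : V →ₗ[ℚ] V) x) (e j),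
      localTubeSpan_units_apply_inv_apply]
  -- orbit vectors: for each `j`, `r` elements of `Γ''` moving `e j` to vectors independent mod `R`
  have horbit : ∀ j, ∃ gs : Fin r → (V →ₗ[ℚ] V)ˣ, (∀ i, gs i ∈ Γ'') ∧
      LinearIndependent ℚ (fun i => R.mkQ (((gs i : (V →ₗ[ℚ] V)ˣ) : V →ₗ[ℚ] V) (e j))) := by
    intro j
    have hsp := localTubeSpan_orbitSpan B hB Δ hΔ (Γ'' ⊔ N) (sup_le hΓ''Γ hNΓ) hMfi (e j) (heΔ j)
    set O : Set (V ⧸ R) :=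
      {y | ∃ g ∈ Γ'', R.mkQ (((g : (V →ₗ[ℚ] V)ˣ) : V →ₗ[ℚ] V) (e j)) = y} with hOdef
    have hO : Submodule.span ℚ O = ⊤ := by
      refine eq_top_iff.2 ?_
      have h1 : (⊤ : Submodule ℚ (V ⧸ R)) = Submodule.map R.mkQ ⊤ := by
        rw [Submodule.map_top, Submodule.range_mkQ]
      rw [h1, ← hsp, Submodule.map_span, Submodule.span_le]
      rintro _ ⟨x, ⟨g', hg', rfl⟩, rfl⟩
      obtain ⟨g, hg, n, hn, rfl⟩ := localTubeSpan_mem_sup_decomp Γ'' N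
        (fun h hh n hn => hnormN h (hΓ''Γ hh) n hn) hg'
      refine Submodule.subset_span ⟨g, hg, ?_⟩
      have hne : ((n : (V →ₗ[ℚ] V)ˣ) : V →ₗ[ℚ] V) (e j) - e j ∈ R := (hUmem _).1 hn.2 (e j)
      rw [Units.val_mul, Module.End.mul_apply, Submodule.mkQ_apply, Submodule.mkQ_apply,
        Submodule.Quotient.eq, ← map_sub]
      have := hfixR g (hΓ''Γ hg) _ (R.neg_mem hne)
      rw [map_neg] at this
      rw [show e j - ((n : (V →ₗ[ℚ] V)ˣ) : V →ₗ[ℚ] V) (e j) =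
        -(((n : (V →ₗ[ℚ] V)ˣ) : V →ₗ[ℚ] V) (e j) - e j) by abel, map_neg, this]
      exact R.neg_mem hne
    obtain ⟨a, haO, hali⟩ := localTubeSpan_exists_linearIndependent_of_span_eq_top O hO hr
    choose gs hgs hgs_eq using haO
    refine ⟨gs, hgs, ?_⟩
    rw [show (fun i => R.mkQ (((gs i : (V →ₗ[ℚ] V)ˣ) : V →ₗ[ℚ] V) (e j))) = a from funext hgs_eq]
    exact hali
  choose gs hgsΓ'' hgsli using horbit
  -- the shear lattice `NΛ`
  obtain ⟨NΛ, hNΛmem, hNΛfg, hNΛfree, hNΛrank⟩ := localTubeSpan_shearLattice B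
    (Submodule.span ℤ Δ) hΔ.fg (by rw [Submodule.span_span_of_tower]; exact hΔ.span_eq_top)
  haveI : Module.Free ℤ NΛ := hNΛfree
  haveI : Module.Finite ℤ NΛ := Module.Finite.iff_fg.2 hNΛfg
  -- the explicit family of shears in `Γ' ⊓ N`, and its independence
  let v : Fin r → Fin k → V := fun i j => ((gs j i : (V →ₗ[ℚ] V)ˣ) : V →ₗ[ℚ] V) (e j)
  let fam : Fin r × Fin k → (V →ₗ[ℚ] V) := fun p =>
    ((gs p.2 p.1 * u p.2 * (gs p.2 p.1)⁻¹ : (V →ₗ[ℚ] V)ˣ) : V →ₗ[ℚ] V) - LinearMap.id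
  have hfam_apply : ∀ p x, fam p x = -((((m p.2 : ℕ) : ℚ) * B x (v p.1 p.2)) • β p.2) := fun p x => by
    change ((gs p.2 p.1 * u p.2 * (gs p.2 p.1)⁻¹ : (V →ₗ[ℚ] V)ˣ) : V →ₗ[ℚ] V) x - x = _
    exact hconj p.2 (gs p.2 p.1) (hgsΓ'' p.2 p.1) x
  have hfamQ : LinearIndependent ℚ fam := by
    refine Fintype.linearIndependent_iff.2 fun c hc p => ?_
    -- evaluate the relation at every `x` and read off the `β`-coordinates
    have hcoef : ∀ (x : V) (j : Fin k), ∑ i, c (i, j) * ((((m j : ℕ) : ℚ)) * B x (v i j)) = 0 := by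
      intro x j
      have hx := LinearMap.congr_fun hc x
      rw [LinearMap.zero_apply, LinearMap.sum_apply, Fintype.sum_prod_type_right] at hx
      simp only [LinearMap.smul_apply, hfam_apply, ← neg_smul, smul_smul, ← Finset.sum_smul] at hx
      have h0 := Fintype.linearIndependent_iff.1 hβli _ hx j
      simp only [mul_neg, Finset.sum_neg_distrib, neg_eq_zero] at h0
      exact h0
    -- hence `w_j = Σ_i c(i,j) m_j • v i j` pairs to zero with everything, so lies in `R`
    have hw : ∀ j, ∑ i, (c (i, j) * ((m j : ℕ) : ℚ)) • v i j ∈ R := fun j => by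
      refine hRof _ fun x => ?_
      rw [map_sum]
      simp only [map_smul, smul_eq_mul, mul_assoc]
      exact hcoef x j
    -- reduce mod `R` and use the independence of the orbit vectors
    have hcm : ∀ j i, c (i, j) * ((m j : ℕ) : ℚ) = 0 := fun j => by
      have h0 : ∑ i, (c (i, j) * ((m j : ℕ) : ℚ)) • R.mkQ (v i j) = 0 := by
        have := (Submodule.Quotient.mk_eq_zero R).2 (hw j)
        rw [← Submodule.mkQ_apply, map_sum] at this
        simpa only [map_smul] using this
      exact Fintype.linearIndependent_iff.1 (hgsli j) _ h0
    have hmne : ((m p.2 : ℕ) : ℚ) ≠ 0 := Nat.cast_ne_zero.2 (hmpos p.2).ne'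
    exact (mul_eq_zero.1 (hcm p.2 p.1)).resolve_right hmne
  have hfamZ : LinearIndependent ℤ fam :=
    hfamQ.restrict_scalars (by
      intro a b hab
      simpa only [zsmul_eq_mul, mul_one, Int.cast_inj] using hab)
  -- the counting lemma on `A = (Γ' ⊓ N).subgroupOf N`
  have h2 : ((Γ' ⊓ N).subgroupOf N).FiniteIndex := by
    refine localTubeSpan_finiteIndex_of_latticeCount ((Γ' ⊓ N).subgroupOf N)
      (fun n : N => (((n : (V →ₗ[ℚ] V)ˣ) : V →ₗ[ℚ] V) - LinearMap.id)) (fun a b => ?_)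
      (fun a b hab => Subtype.ext (Units.ext (sub_left_inj.1 hab))) NΛ hNΛrank (fun n => ?_)
      (ι := Fin r × Fin k) ?_ fam hfamZ (fun p => ?_)
    · -- multiplicativity on `N`
      ext x
      have hb : (((b : N) : (V →ₗ[ℚ] V)ˣ) : V →ₗ[ℚ] V) x - x ∈ R := (hUmem _).1 b.2.2 x
      have ha := hfixR _ a.2.1 _ hb
      rw [map_sub] at ha
      simp only [LinearMap.sub_apply, LinearMap.add_apply, LinearMap.id_apply, Subgroup.coe_mul,
        Units.val_mul, Module.End.mul_apply]
      calc (((a : N) : (V →ₗ[ℚ] V)ˣ) : V →ₗ[ℚ] V) ((((b : N) : (V →ₗ[ℚ] V)ˣ) : V →ₗ[ℚ] V) x) - x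
          = ((((a : N) : (V →ₗ[ℚ] V)ˣ) : V →ₗ[ℚ] V) ((((b : N) : (V →ₗ[ℚ] V)ˣ) : V →ₗ[ℚ] V) x) -
              (((a : N) : (V →ₗ[ℚ] V)ˣ) : V →ₗ[ℚ] V) x) +
            ((((a : N) : (V →ₗ[ℚ] V)ˣ) : V →ₗ[ℚ] V) x - x) := by abel
        _ = (((a : N) : (V →ₗ[ℚ] V)ˣ) : V →ₗ[ℚ] V) x - x +
            ((((b : N) : (V →ₗ[ℚ] V)ˣ) : V →ₗ[ℚ] V) x - x) := by rw [ha]; abel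
    · -- values in the shear lattice
      refine (hNΛmem _).2 ⟨fun x => (hUmem _).1 n.2.2 x, fun ρ hρ => ?_, fun x hx => ?_⟩
      · rw [LinearMap.sub_apply, LinearMap.id_apply, hfixR _ n.2.1 _ hρ, sub_self]
      · rw [LinearMap.sub_apply, LinearMap.id_apply]
        exact Submodule.sub_mem _
          (localTubeSpan_transvectionGroup_map_span_int B hB Δ hΔ.integral n.2.1 hx) hx
    · rw [Fintype.card_prod, Fintype.card_fin, Fintype.card_fin, hr]
    · refine ⟨⟨gs p.2 p.1 * u p.2 * (gs p.2 p.1)⁻¹, ?_⟩, ?_, rfl⟩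
      · exact hnormN _ (hΓ''Γ (hgsΓ'' p.2 p.1)) _ (huN p.2)
      · rw [Subgroup.mem_subgroupOf]
        refine ⟨Γ'.mul_mem (Γ'.mul_mem (hΓ''Γ' (hgsΓ'' p.2 p.1)) (huΓ' p.2))
          (Γ'.inv_mem (hΓ''Γ' (hgsΓ'' p.2 p.1))), ?_⟩
        exact hnormN _ (hΓ''Γ (hgsΓ'' p.2 p.1)) _ (huN p.2)
  -- conclude
  exact localTubeSpan_indexBookkeeping Γ Γ' N hΓ'Γ hNΓ hnormN C hC
    (fun g hg => by
      obtain ⟨c, hc, h, hh', n, hn, rfl⟩ := hdecΓ g hg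
      exact ⟨c, hc, h, hΓ''Γ' hh', n, hn, rfl⟩) h2

end FrameLift

end Summit.HodgeConjecture.HodgeConjecture.Theorems

end
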